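import Mathlib
import Literature.Analysis.FluidPDE.SelfSimilar
import Literature.Analysis.FluidPDE.AxisymmetricEuler
import Literature.Analysis.FluidPDE.AxisymmetricReflection
import Literature.Analysis.FluidPDE.TypeIAncientMild
import Literature.Analysis.FluidPDE.PineauVicolRSS
import Literature.Analysis.FluidPDE.OseenZoomCovariance
import Literature.Analysis.FluidPDE.OseenMildUniqueness
import Literature.Analysis.FluidPDE.PineauVicolRDSSLeray
import Literature.Analysis.FluidPDE.PineauVicolRSSChaeWolf
import Summits.NavierStokesRegularity.NavierStokesRegularity.Theorems.QuantisedSymmetryPolyhedralDssProfileExistsStubAncientMildOfClassicalTypeI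
import Summits.NavierStokesRegularity.NavierStokesRegularity.Theorems.DssFarFieldSlavingBlowupTypeIDssProfileSmoothRepresentativeAe
import Summits.NavierStokesRegularity.NavierStokesRegularity.Theorems.DssFarFieldSlavingBlowupTypeIDssProfileAxisymmetricEmpty
import Summits.NavierStokesRegularity.NavierStokesRegularity.Theorems.DssFarFieldSlavingBlowupTypeIDssProfileClassToProfile
import Summits.NavierStokesRegularity.NavierStokesRegularity.Theorems.CorkscrewDynamoCorkscrewProfileAngleTools
import HarnessLib

/-!
# T22 — the CO-ROTATING mirror cell is EMPTY (route `DssFarFieldSlaving`, crux `BlowupTypeIDssProfile`,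
  stmt-NavierStokesRegularity-0155 — SUPPORT; cell pub-ns-dss theory seat, red R-31(c), lead A45;
  landed by the typer from the theory seat's tree-ready file HOME/theory/ReversingIsotropyEmpty.lean
  v1.7a, sha256[16] 3756fc160d143494)

`mirrorCorotating_trivial` / `rdssClass_mirrorCorotating_empty` / `mirrorCorotating_rss_liouville`: a
Type-I ancient field that is a Pineau–Vicol RSS field `pvAnsatz α U` (`α ≠ 0`) whose co-rotating
profile `U` is equivariant under a rotation-REVERSING isometry `g` (`g R_φ = R_{−φ} g`) has `U = 0` —
in the Oseen gauge (`IsTypeIAncientMild`), at CLASS level (ancient mild + measurable slices + Type-I,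
continuous profile), and in the window-classical phrasing of Pineau–Vicol 2026 Thm 1.4.  PROOF
(theory seat; not a time-reversal argument): the reflected field `g⁻¹ u(t, g·)` solves the same Oseen
integral equation (`oseenDuhamel_symm_conj_linearIsometryEquiv`, `heatExtension_conj_linearIsometryEquiv`)
with the same slice `U` at `t = −1` and equals `pvAnsatz (−α) U` (`reflect_pvAnsatz`); forward
uniqueness of bounded Oseen-mild fields (`oseenMild_bounded_unique`, KNSS 2009 §4) on `(−1, T)`,
`T < 0`, forces `pvAnsatz α U = pvAnsatz (−α) U` there, i.e. `U` is `R_{2αs}`-equivariant for every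
`s > 0` — a half-line of angles, hence axisymmetric by `2π`-periodicity (`isAxisymmetric_of_halfLine`)
— and KNSS Thm 5.3 (`typeI_ancient_axisymmetric_ae_zero`) kills the then axisymmetric slices.
`α = 0` is the steady (Tsai) cell, not this file.

Typer changes w.r.t. the theory file: `ReversesRotZ g` written out as `∀ φ y, g (rotZ φ y) = rotZ (−φ) (g y)`;
the `2π`-periodicity lemma is the tree's `CorkscrewProfile.Birth.rotZ_add_int_mul_two_pi`.
[cite: KochNadirashviliSereginSverak2009, §4 and Thm 5.3 (arXiv:0709.3599)]
-/

noncomputable section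

set_option linter.dupNamespace false

namespace Summit.NavierStokesRegularity.NavierStokesRegularity.Theorems.ReversingIsotropy

open MeasureTheory Set Function Filter Metric
open Literature.Analysis.FluidPDE
open Summit.NavierStokesRegularity.NavierStokesRegularity.Theorems
open scoped Topology

/-- Rotations about the axis commute with scalar multiplication (via the bundled `rotZL`). -/
private theorem rotZ_smul' (θ c : ℝ) (y : (EuclideanSpace ℝ (Fin 3))) : rotZ θ (c • y) = c • rotZ θ y := by
  rw [← rotZL_apply, map_smul, rotZL_apply]

/-- `rotZ θ` is continuous (via the bundled `rotZL θ`). -/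
private theorem continuous_rotZ_map (θ : ℝ) : Continuous (rotZ θ : (EuclideanSpace ℝ (Fin 3)) → (EuclideanSpace ℝ (Fin 3))) := by
  have : (rotZ θ : (EuclideanSpace ℝ (Fin 3)) → (EuclideanSpace ℝ (Fin 3))) = rotZL θ := by funext x; rw [rotZL_apply]
  rw [this]; exact (rotZL θ).continuous

/-- Reflecting an RSS field whose co-rotating profile is `g`-equivariant reverses the angular speed. -/
theorem reflect_pvAnsatz {α : ℝ} {g : (EuclideanSpace ℝ (Fin 3)) ≃ₗᵢ[ℝ] (EuclideanSpace ℝ (Fin 3))} (hg : (∀ φ y, g (rotZ φ y) = rotZ (-φ) (g y)))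
    {U : (EuclideanSpace ℝ (Fin 3)) → (EuclideanSpace ℝ (Fin 3))}
    (hGU : ∀ y, U (g y) = g (U y)) (t : ℝ) (x : (EuclideanSpace ℝ (Fin 3))) :
    g.symm (pvAnsatz α (fun y _ => U y) t (g x)) = pvAnsatz (-α) (fun y _ => U y) t x := by
  have hang : -α * -Real.log (-t) = -(α * -Real.log (-t)) := by ring
  have rhs : pvAnsatz (-α) (fun y _ => U y) t x =
      (Real.sqrt (-t))⁻¹ • rotZ (-(α * -Real.log (-t)))
        (U (rotZ (α * -Real.log (-t)) ((Real.sqrt (-t))⁻¹ • x))) := by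
    show (Real.sqrt (-t))⁻¹ • rotZ (-α * -Real.log (-t))
        (U (rotZ (-(-α * -Real.log (-t))) ((Real.sqrt (-t))⁻¹ • x))) = _
    rw [hang, neg_neg]
  have lhs : pvAnsatz α (fun y _ => U y) t (g x) =
      (Real.sqrt (-t))⁻¹ • rotZ (α * -Real.log (-t))
        (U (rotZ (-(α * -Real.log (-t))) ((Real.sqrt (-t))⁻¹ • g x))) := rfl
  rw [lhs, rhs, LinearIsometryEquiv.map_smul]
  congr 1
  set φ : ℝ := α * -Real.log (-t)
  set lam : ℝ := (Real.sqrt (-t))⁻¹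
  have e1 : lam • g x = g (lam • x) := (g.map_smul lam x).symm
  have e2 : rotZ (-φ) (g (lam • x)) = g (rotZ φ (lam • x)) := (hg φ (lam • x)).symm
  have e3 : rotZ φ (g (U (rotZ φ (lam • x)))) = g (rotZ (-φ) (U (rotZ φ (lam • x)))) := by
    have h := hg (-φ) (U (rotZ φ (lam • x)))
    rw [neg_neg] at h
    exact h.symm
  rw [e1, e2, hGU, e3, LinearIsometryEquiv.symm_apply_apply]

/-- A half-line of equivariance angles already gives axisymmetry (no continuity needed). -/
theorem isAxisymmetric_of_halfLine {α : ℝ} (hα : α ≠ 0) {U : (EuclideanSpace ℝ (Fin 3)) → (EuclideanSpace ℝ (Fin 3))}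
    (h : ∀ σ : ℝ, 0 < σ → ∀ w, U (rotZ (2 * (α * σ)) w) = rotZ (2 * (α * σ)) (U w)) :
    IsAxisymmetric U := by
  intro β w
  have hπ : 0 < 2 * Real.pi := by positivity
  obtain ⟨k, hk⟩ : ∃ k : ℤ, 0 < (β + k * (2 * Real.pi)) / (2 * α) := by
    rcases lt_or_gt_of_ne hα with hneg | hpos
    · refine ⟨⌊-β / (2 * Real.pi)⌋ - 1, div_pos_of_neg_of_neg ?_ (by linarith)⟩
      have h1 : ((⌊-β / (2 * Real.pi)⌋ : ℤ) : ℝ) ≤ -β / (2 * Real.pi) := Int.floor_le _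
      have h2 : (((⌊-β / (2 * Real.pi)⌋ - 1 : ℤ) : ℝ)) = (⌊-β / (2 * Real.pi)⌋ : ℝ) - 1 := by
        push_cast; ring
      rw [h2]
      have h3 : ((⌊-β / (2 * Real.pi)⌋ : ℝ) - 1) * (2 * Real.pi) ≤ -β - 2 * Real.pi := by
        have := mul_le_mul_of_nonneg_right h1 hπ.le
        rw [div_mul_cancel₀ _ hπ.ne'] at this
        linarith
      linarith
    · refine ⟨⌊-β / (2 * Real.pi)⌋ + 1, div_pos ?_ (by linarith)⟩
      have h1 : -β / (2 * Real.pi) < (⌊-β / (2 * Real.pi)⌋ : ℝ) + 1 := Int.lt_floor_add_one _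
      have h2 : (((⌊-β / (2 * Real.pi)⌋ + 1 : ℤ) : ℝ)) = (⌊-β / (2 * Real.pi)⌋ : ℝ) + 1 := by
        push_cast; ring
      rw [h2]
      have h3 : -β < ((⌊-β / (2 * Real.pi)⌋ : ℝ) + 1) * (2 * Real.pi) := by
        have := mul_lt_mul_of_pos_right h1 hπ
        rw [div_mul_cancel₀ _ hπ.ne'] at this
        linarith
      linarith
  have hσ := h ((β + k * (2 * Real.pi)) / (2 * α)) hk w
  have h2 : 2 * (α * ((β + k * (2 * Real.pi)) / (2 * α))) = β + k * (2 * Real.pi) := by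
    field_simp
  rw [h2, CorkscrewProfile.Birth.rotZ_add_int_mul_two_pi,
    CorkscrewProfile.Birth.rotZ_add_int_mul_two_pi] at hσ
  exact hσ

/-- **T22 (Oseen gauge): an RSS Type-I ancient mild field whose co-rotating profile is equivariant
under a rotation-reversing isometry is trivial.** -/
theorem mirrorCorotating_trivial {C₀ α : ℝ} (hα : α ≠ 0) {g : (EuclideanSpace ℝ (Fin 3)) ≃ₗᵢ[ℝ] (EuclideanSpace ℝ (Fin 3))}
    (hg : (∀ φ y, g (rotZ φ y) = rotZ (-φ) (g y)))
    {V : ℝ → (EuclideanSpace ℝ (Fin 3)) → (EuclideanSpace ℝ (Fin 3))} (hV : IsTypeIAncientMild C₀ V) (hdec : HasTypeIDecay C₀ V)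
    {U : (EuclideanSpace ℝ (Fin 3)) → (EuclideanSpace ℝ (Fin 3))} (hGU : ∀ y, U (g y) = g (U y))
    (hans : ∀ t < 0, ∀ x, V t x = pvAnsatz α (fun y _ => U y) t x) : U = 0 := by
  -- continuity of slices and sign of the constant
  have hVc : ∀ t < 0, Continuous (V t) := fun t ht => by
    have h : ContinuousOn (uncurry V ∘ fun x : (EuclideanSpace ℝ (Fin 3)) => (t, x)) univ :=
      hV.1.continuousOn.comp (continuous_const.prodMk continuous_id).continuousOn
        fun x _ => ⟨ht, mem_univ _⟩
    exact (continuousOn_univ.1 h).congr fun x => rfl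
  have hC₀ : 0 ≤ C₀ := by
    have h1 := hdec (-1) (by norm_num) 0
    rw [norm_zero, zero_add] at h1
    by_contra hneg
    have h2 : C₀ / Real.sqrt (-(-1 : ℝ)) < 0 :=
      div_neg_of_neg_of_pos (lt_of_not_ge hneg) (Real.sqrt_pos.2 (by norm_num))
    linarith [norm_nonneg (V (-1) 0)]
  -- the reflected field and its slice at `-1`
  set W : ℝ → (EuclideanSpace ℝ (Fin 3)) → (EuclideanSpace ℝ (Fin 3)) := fun t x => g.symm (V t (g x)) with hW
  have hW1 : ∀ y, g.symm (V (-1) (g y)) = V (-1) y := fun y => by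
    rw [hans (-1) (by norm_num), hans (-1) (by norm_num), pvAnsatz_neg_one, pvAnsatz_neg_one, hGU,
      LinearIsometryEquiv.symm_apply_apply]
  -- both solve the Oseen equation from `s = -1` with the same free term
  have hVeq : ∀ t ∈ Ioo (-1 : ℝ) 0, ∀ x,
      V t x = heatFlow (V (-1)) (t - (-1)) x - oseenDuhamel 1 (-1) V V t x :=
    fun t ht x => hV.2.2.1 (-1) t ht.1 ht.2 x
  have hWeq : ∀ t ∈ Ioo (-1 : ℝ) 0, ∀ x,
      W t x = heatFlow (V (-1)) (t - (-1)) x - oseenDuhamel 1 (-1) W W t x := by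
    intro t ht x
    have hpos : 0 < t - (-1) := by linarith [ht.1]
    show g.symm (V t (g x)) = _
    rw [hVeq t ht (g x), map_sub, heatFlow_of_pos _ hpos,
      oseenDuhamel_symm_conj_linearIsometryEquiv g 1 (-1) V V t x]
    congr 1
    have h := heatExtension_conj_linearIsometryEquiv g.symm (V (-1)) (t - (-1)) x
    simp only [LinearIsometryEquiv.symm_symm] at h
    rw [← h]
    congr 1
    funext y
    exact hW1 y
  -- forward uniqueness of bounded Oseen-mild fields: `V = W` on `(-1, 0)`
  have hVW : ∀ t ∈ Ioo (-1 : ℝ) 0, V t = W t := by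
    intro t ht
    have hT0 : t / 2 < 0 := by linarith [ht.2]
    have htT : t < t / 2 := by linarith [ht.2]
    have hM0 : 0 ≤ C₀ / Real.sqrt (-(t / 2)) := div_nonneg hC₀ (Real.sqrt_nonneg _)
    have hbound : ∀ τ ∈ Ioo (-1 : ℝ) (t / 2), ∀ y, ‖V τ y‖ ≤ C₀ / Real.sqrt (-(t / 2)) := by
      intro τ hτ y
      have hτ0 : τ < 0 := lt_trans hτ.2 hT0
      calc ‖V τ y‖ ≤ C₀ / (‖y‖ + Real.sqrt (-τ)) := hdec τ hτ0 y
        _ ≤ C₀ / Real.sqrt (-(t / 2)) := by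
          apply div_le_div_of_nonneg_left hC₀ (Real.sqrt_pos.2 (by linarith))
          have : Real.sqrt (-(t / 2)) ≤ Real.sqrt (-τ) := Real.sqrt_le_sqrt (by linarith [hτ.2])
          linarith [norm_nonneg y]
    have hboundW : ∀ τ ∈ Ioo (-1 : ℝ) (t / 2), ∀ y, ‖W τ y‖ ≤ C₀ / Real.sqrt (-(t / 2)) :=
      fun τ hτ y => by
        show ‖g.symm (V τ (g y))‖ ≤ _
        rw [LinearIsometryEquiv.norm_map]
        exact hbound τ hτ (g y)
    have hcontV : ContinuousOn (uncurry V) (Ioo (-1 : ℝ) (t / 2) ×ˢ univ) :=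
      hV.1.continuousOn.mono (prod_mono (fun τ hτ => lt_trans hτ.2 hT0) subset_rfl)
    have hmeasV : AEStronglyMeasurable (uncurry V)
        ((volume : Measure (ℝ × (EuclideanSpace ℝ (Fin 3)))).restrict (Ioo (-1 : ℝ) (t / 2) ×ˢ univ)) :=
      hcontV.aestronglyMeasurable (measurableSet_Ioo.prod MeasurableSet.univ)
    have hcontW : ContinuousOn (uncurry W) (Ioo (-1 : ℝ) (t / 2) ×ˢ univ) := by
      have hWf : uncurry W = g.symm ∘ uncurry V ∘ fun q : ℝ × (EuclideanSpace ℝ (Fin 3)) => (q.1, g q.2) := by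
        funext q; rfl
      rw [hWf]
      refine g.symm.continuous.comp_continuousOn (hcontV.comp
        (continuous_fst.prodMk (g.continuous.comp continuous_snd)).continuousOn ?_)
      intro q hq
      exact ⟨hq.1, mem_univ _⟩
    have hmeasW : AEStronglyMeasurable (uncurry W)
        ((volume : Measure (ℝ × (EuclideanSpace ℝ (Fin 3)))).restrict (Ioo (-1 : ℝ) (t / 2) ×ˢ univ)) :=
      hcontW.aestronglyMeasurable (measurableSet_Ioo.prod MeasurableSet.univ)
    have huniq := oseenMild_bounded_unique (u := V) (v := W)
      (U := fun τ x => heatFlow (V (-1)) (τ - (-1)) x) (s := -1) (T := t / 2) one_pos hM0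
      hmeasV hmeasW hbound hboundW
      (fun τ hτ => Filter.Eventually.of_forall fun x => hVeq τ ⟨hτ.1, lt_trans hτ.2 hT0⟩ x)
      (fun τ hτ => Filter.Eventually.of_forall fun x => hWeq τ ⟨hτ.1, lt_trans hτ.2 hT0⟩ x)
    exact Measure.eq_of_ae_eq (huniq t ⟨ht.1, htT⟩) (hVc t ht.2)
      (g.symm.continuous.comp ((hVc t ht.2).comp g.continuous))
  -- `U` is `R_{2ασ}`-equivariant for every `σ > 0`
  have hequi : ∀ σ : ℝ, 0 < σ → ∀ w, U (rotZ (2 * (α * σ)) w) = rotZ (2 * (α * σ)) (U w) := by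
    intro σ hσ w
    have ht0 : -Real.exp (-σ) < 0 := neg_neg_of_pos (Real.exp_pos _)
    have ht1 : -1 < -Real.exp (-σ) := by
      rw [neg_lt_neg_iff]
      exact Real.exp_lt_one_iff.2 (by linarith)
    have hlog : -Real.log (Real.exp (-σ)) = σ := by rw [Real.log_exp, neg_neg]
    have hsq : 0 < Real.sqrt (Real.exp (-σ)) := Real.sqrt_pos.2 (Real.exp_pos _)
    have key : ∀ z : (EuclideanSpace ℝ (Fin 3)), rotZ (α * σ) (U (rotZ (-(α * σ)) z)) = rotZ (-(α * σ)) (U (rotZ (α * σ) z)) := by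
      intro z
      have h := congrFun (hVW (-Real.exp (-σ)) ⟨ht1, ht0⟩) (Real.sqrt (-(-Real.exp (-σ))) • z)
      have hWz : W (-Real.exp (-σ)) (Real.sqrt (-(-Real.exp (-σ))) • z) =
          pvAnsatz (-α) (fun y _ => U y) (-Real.exp (-σ)) (Real.sqrt (-(-Real.exp (-σ))) • z) := by
        show g.symm (V _ (g _)) = _
        rw [hans _ ht0, reflect_pvAnsatz hg hGU]
      rw [hWz, hans _ ht0] at h
      simp only [pvAnsatz, neg_neg, hlog, smul_smul, inv_mul_cancel₀ hsq.ne', one_smul, neg_mul] at h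
      have h' : (Real.sqrt (Real.exp (-σ)))⁻¹ • rotZ (α * σ) (U (rotZ (-(α * σ)) z)) =
          (Real.sqrt (Real.exp (-σ)))⁻¹ • rotZ (-(α * σ)) (U (rotZ (α * σ) z)) := h
      exact smul_right_injective _ (inv_ne_zero hsq.ne') h'
    have h1 := key (rotZ (α * σ) w)
    rw [← rotZ_add, neg_add_cancel, rotZ_zero, ← rotZ_add] at h1
    -- h1 : rotZ (α σ) (U w) = rotZ (-(ασ)) (U (rotZ (ασ + ασ) w))
    have h2 := congrArg (rotZ (α * σ)) h1
    rw [← rotZ_add, ← rotZ_add, add_neg_cancel, rotZ_zero] at h2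
    rw [show 2 * (α * σ) = α * σ + α * σ by ring]
    exact h2.symm
  have hax : IsAxisymmetric U := isAxisymmetric_of_halfLine hα hequi
  -- the slices of `V` are axisymmetric
  have hVax : ∀ t < 0, IsAxisymmetric (V t) := by
    intro t ht θ x
    rw [hans t ht, hans t ht]
    simp only [pvAnsatz]
    have hU : ∀ z, rotZ (α * -Real.log (-t)) (U (rotZ (-(α * -Real.log (-t))) z)) = U z :=
      fun z => by rw [hax (-(α * -Real.log (-t))) z, ← rotZ_add, add_neg_cancel, rotZ_zero]
    rw [← rotZ_smul' θ _ x, hU, hU, hax θ, rotZ_smul']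
  -- KNSS
  have hVmeas : ∀ t < 0, AEStronglyMeasurable (V t) volume := fun t ht =>
    (hVc t ht).aestronglyMeasurable
  have hz := typeI_ancient_axisymmetric_ae_zero hV.isAncientMildSolution hVmeas hdec hVax (-1)
    (by norm_num)
  have hV1 : V (-1) = 0 := Measure.eq_of_ae_eq hz (hVc _ (by norm_num)) continuous_const
  funext y
  have hy := congrFun hV1 y
  rw [hans (-1) (by norm_num), pvAnsatz_neg_one] at hy
  exact hy

/-- **T22 at CLASS level: the co-rotating mirror cell is EMPTY.** A member of the class (ancient mild,
measurable slices, Type-I `M`) that is a Pineau–Vicol RSS field with angular speed `α ≠ 0` and a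
continuous co-rotating profile `U` equivariant under a rotation-reversing isometry has `U = 0`. -/
theorem rdssClass_mirrorCorotating_empty {M α : ℝ} (hα : α ≠ 0) {g : (EuclideanSpace ℝ (Fin 3)) ≃ₗᵢ[ℝ] (EuclideanSpace ℝ (Fin 3))}
    (hg : (∀ φ y, g (rotZ φ y) = rotZ (-φ) (g y))) {U : (EuclideanSpace ℝ (Fin 3)) → (EuclideanSpace ℝ (Fin 3))} (hU : Continuous U)
    (hGU : ∀ y, U (g y) = g (U y))
    {u : ℝ → (EuclideanSpace ℝ (Fin 3)) → (EuclideanSpace ℝ (Fin 3))} (hmild : IsAncientMildSolution 1 u)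
    (hmeas : ∀ t < 0, AEStronglyMeasurable (u t) volume) (hdec : HasTypeIDecay M u)
    (hans : ∀ t < 0, ∀ x, u t x = pvAnsatz α (fun y _ => U y) t x) : U = 0 := by
  obtain ⟨V, hT, hVdec, hVu, -⟩ := typeI_ancient_smoothRepresentative_ae hmild hmeas hdec
  have hVc : ∀ t < 0, Continuous (V t) := fun t ht => by
    have h : ContinuousOn (uncurry V ∘ fun x : (EuclideanSpace ℝ (Fin 3)) => (t, x)) univ :=
      hT.1.continuousOn.comp (continuous_const.prodMk continuous_id).continuousOn
        fun x _ => ⟨ht, mem_univ _⟩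
    exact (continuousOn_univ.1 h).congr fun x => rfl
  have huc : ∀ t < 0, Continuous (u t) := fun t ht => by
    have : u t = fun x => pvAnsatz α (fun y _ => U y) t x := funext (hans t ht)
    rw [this]
    exact ((continuous_rotZ_map _).comp (hU.comp ((continuous_rotZ_map _).comp
      (continuous_const_smul ((Real.sqrt (-t))⁻¹ : ℝ))))).const_smul ((Real.sqrt (-t))⁻¹ : ℝ)
  have hVeq : ∀ t < 0, V t = u t := fun t ht => Measure.eq_of_ae_eq (hVu t ht) (hVc t ht) (huc t ht)
  exact mirrorCorotating_trivial hα hg hT hVdec hGU fun t ht x => by rw [hVeq t ht]; exact hans t ht x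

/-- **T22 in the window-classical phrasing of Pineau–Vicol 2026 Thm 1.4's setting.** A classical
solution on `(EuclideanSpace ℝ (Fin 3)) × [−1, 0)` with the Type-I bound (1.10), backwards RSS with angular speed `α ≠ 0` and a
profile `U` (the `C²` hypothesis is carried for conformity with `PV2026RSSLiouvilleStatement` and not
used) which is equivariant under a rotation-reversing isometry, has `U ≡ 0`. Proof: extend to the
past (`PineauVicol2026.exists_isClassicalNSSolutionOn_Iio_of_isRotatedDSS`, PV footnote 13), transfer
the Type-I bound (`profile_bound_of_typeI`, `norm_pvAnsatz_le_of_profile`, PV Remark 1.2), pass to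
the KNSS gauge (`isTypeIAncientMild_of_classical_typeI`, KNSS 2009 Thm 6.1) and apply
`mirrorCorotating_trivial`. -/
theorem mirrorCorotating_rss_liouville {C₀ α : ℝ} (hα : α ≠ 0) {g : (EuclideanSpace ℝ (Fin 3)) ≃ₗᵢ[ℝ] (EuclideanSpace ℝ (Fin 3))}
    (hg : (∀ φ y, g (rotZ φ y) = rotZ (-φ) (g y)))
    {u : ℝ → (EuclideanSpace ℝ (Fin 3)) → (EuclideanSpace ℝ (Fin 3))} {p : ℝ → (EuclideanSpace ℝ (Fin 3)) → ℝ} {U : (EuclideanSpace ℝ (Fin 3)) → (EuclideanSpace ℝ (Fin 3))}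
    (hsol : IsClassicalNSSolutionOn (Ico (-1) 0) 1 0 u p)
    (hI : ∀ t ∈ Ico (-1 : ℝ) 0, ∀ x, ‖u t x‖ ≤ C₀ / (‖x‖ + Real.sqrt (-t)))
    (hGU : ∀ y, U (g y) = g (U y))
    (hans : ∀ t ∈ Ico (-1 : ℝ) 0, ∀ x, u t x = pvAnsatz α (fun y _ => U y) t x) : U = 0 := by
  obtain ⟨P, hP⟩ := PineauVicol2026.exists_isClassicalNSSolutionOn_Iio_of_isRotatedDSS hsol
    one_lt_two (PineauVicol2026.isRotatedDSS_pvAnsatz (α := α) (U := fun y _ => U y) two_pos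
      fun _ _ => rfl) hans
  have hIw : HasTypeIDecay C₀ (pvAnsatz α (fun y _ => U y)) := fun t ht x =>
    norm_pvAnsatz_le_of_profile (profile_bound_of_typeI hI hans) ht x
  exact mirrorCorotating_trivial hα hg
    (PolyhedralDssProfileExists.Birth.isTypeIAncientMild_of_classical_typeI hP hIw) hIw hGU
    fun t _ x => rfl

end Summit.NavierStokesRegularity.NavierStokesRegularity.Theorems.ReversingIsotropy

end
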